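import Summits.KontsevichZagierPeriods.Zeta5Search.LaiSweepShard

/-!
# `κ₃` sweep certificate — shard file 024 of 127 (shards 168–174 of 889)

HONEST FRAMING. Systematic search; no irrationality claim unless certified. This file only checks,
by `decide +kernel`, shards 168–174 of the order-cell sweep of the `κ₃` point `(74, 2180, 444; δ74)`
(engine `LaiSweepEngine`, soundness `LaiSweepJump/Free/Eval/Shard/Kappa3`; a shard is `⟨regime, n,
p, q, p', q', Lo, Up⟩`: `n` cells from `p/q` to `p'/q'` with integer rate sums in `[Lo, Up]`, `K =
128`, `D = 2^40`). It draws NO conclusion: only the capstone `LaiKappa3SweepCert`, which needs all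
127 shard files, does. Kernel cost of this file ≈ 560 cells × 0.3 s.
-/

namespace Summit.KontsevichZagierPeriods.Zeta5Search.Sweep

set_option maxHeartbeats 100000000 in
/-- Shard 168: 80 cells of regime B from `11/118` to `29/307`.
[cite: Lai2024BallRivoal, §4 Lemma 4.3] -/
theorem shard168 :
    Shard.check 128 (2^40)
      ⟨true, 80, 11, 118, 29, 307, 69018082234446, 69374309492040⟩ = true := by
  decide +kernel

set_option maxHeartbeats 100000000 in
/-- Shard 169: 80 cells of regime B from `29/307` to `38/397`.
[cite: Lai2024BallRivoal, §4 Lemma 4.3] -/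
theorem shard169 :
    Shard.check 128 (2^40)
      ⟨true, 80, 29, 307, 38, 397, 69027807715182, 69398382834850⟩ = true := by
  decide +kernel

set_option maxHeartbeats 100000000 in
/-- Shard 170: 80 cells of regime B from `38/397` to `29/299`.
[cite: Lai2024BallRivoal, §4 Lemma 4.3] -/
theorem shard170 :
    Shard.check 128 (2^40)
      ⟨true, 80, 38, 397, 29, 299, 68684591667388, 69058375933389⟩ = true := by
  decide +kernel

set_option maxHeartbeats 100000000 in
/-- Shard 171: 80 cells of regime B from `29/299` to `39/397`.
[cite: Lai2024BallRivoal, §4 Lemma 4.3] -/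
theorem shard171 :
    Shard.check 128 (2^40)
      ⟨true, 80, 29, 299, 39, 397, 66540564984316, 66912546533939⟩ = true := by
  decide +kernel

set_option maxHeartbeats 100000000 in
/-- Shard 172: 80 cells of regime B from `39/397` to `18/181`.
[cite: Lai2024BallRivoal, §4 Lemma 4.3] -/
theorem shard172 :
    Shard.check 128 (2^40)
      ⟨true, 80, 39, 397, 18, 181, 63756499828787, 64120511697701⟩ = true := by
  decide +kernel

set_option maxHeartbeats 100000000 in
/-- Shard 173: 80 cells of regime B from `18/181` to `121/1201`.
[cite: Lai2024BallRivoal, §4 Lemma 4.3] -/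
theorem shard173 :
    Shard.check 128 (2^40)
      ⟨true, 80, 18, 181, 121, 1201, 67321799018196, 67737821267337⟩ = true := by
  decide +kernel

set_option maxHeartbeats 100000000 in
/-- Shard 174: 80 cells of regime B from `121/1201` to `41/402`.
[cite: Lai2024BallRivoal, §4 Lemma 4.3] -/
theorem shard174 :
    Shard.check 128 (2^40)
      ⟨true, 80, 121, 1201, 41, 402, 63414626968930, 63797869634758⟩ = true := by
  decide +kernel

/-- The checked shards of this file, in order. [folklore] -/
def shards024 : List (CheckedShard 128 (2^40)) :=
  [⟨_, shard168⟩, ⟨_, shard169⟩, ⟨_, shard170⟩, ⟨_, shard171⟩, ⟨_, shard172⟩,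
    ⟨_, shard173⟩, ⟨_, shard174⟩]

end Summit.KontsevichZagierPeriods.Zeta5Search.Sweep
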